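import Literature.Geometry.Kaehler.ComplexTorusCMTypeModelsImprimitiveDegreeLeTwelveHodgeClasses
import Literature.AlgebraicGeometry.Pohlmann1968.CMFieldTwicePrimeDegreeAllPowersHodgeConjecture
import Literature.AlgebraicGeometry.ComplexMultiplication.MumfordTateTorusAbelianVarietyRankLowerBounds
import HarnessLib

/-!
# Complex tori of PRIME dimension `ℓ` with complex multiplication by a CM field of degree `2ℓ` (any type), and complex tori with an endomorphism
# of characteristic polynomial `Φ_d`, `φ(d) = 2ℓ`: the Hodge classes of all their powers are generated by divisor classes

Layer `Literature/Geometry/Kaehler`, namespace `Literature.Geometry.Kaehler.ComplexTorus`; lane `lit-hodgefound` (Track 2 foundations library),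
prover seat `lit-hodgefound-p10`, generation 33, row «A2-26(hq)» (self-proposed 2026-08-28).  Theorems only; no `def`, no instance, no named fact
(net Literature debt 0).  Torus-side twin of `Pohlmann1968/CMFieldTwicePrimeDegreeAllPowersHodgeConjecture`.

`K` a CM field, `[K : ℚ] = 2ℓ`, `ℓ` prime; `X = ℂ^ℓ/Φ(𝔞)`.  `Φ` primitive: `X` is a SIMPLE abelian variety of prime dimension with a Mumford–Tate
torus — Yanai–Tankeev–Ribet, structure-free in the tree (`IsAbelianVariety.divisorClasses_powPeriod_eq_hodgeClasses_of_isSimple_of_card_eq_two_mul_prime_…`).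
`Φ` not primitive: induced from an imaginary quadratic subfield (the sibling's `finrank_eq_two_of_not_isPrimitive_of_finrank_eq_two_mul_prime`),
`X ∼ E^ℓ`, `E` a CM elliptic curve; transported (`forall_powPeriod_divisorClasses_eq_hodgeClasses_iff_of_isIsogenous_powPeriod`).  For a torus with
`P_u = Φ_d`, `φ(d) = 2ℓ` (`d = 7, 9, 11, 14, 18, 22, 23, 46, 47, 59, …`): `X ≅ ℂ^ℓ/Φ(𝔞)` for `ℚ(ζ_d)` (generation 31).

* **`divisorClasses_powPeriod_periodIso_eq_hodgeClasses_of_finrank_eq_two_mul_prime`** (all types, all ideals),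
  **`divisorClasses_powPeriod_eq_hodgeClasses_of_charpoly_eq_cyclotomic_of_totient_eq_two_mul_prime`** (`Hdg(Xᵏ) = Div(Xᵏ)` for every complex
  torus with an endomorphism of characteristic polynomial `Φ_d`, `φ(d)` twice a prime — e.g. `Φ₁₁`, `Φ₂₂`, `Φ₂₃`, `Φ₄₇`).

## References

* [Yanai1985] H. Yanai, *On degenerate CM-types*, J. Number Theory 21 (1985), §4 Theorem (p. 171).
* [Gordon1999HodgeAVSurvey] B. B. Gordon (1999), Thm. 6.3 (2) and Remark, 7.5, §9.3.
* [MoonenZarhin1999LowDim] B. Moonen, Yu. Zarhin, Math. Ann. 315 (1999), §2 Thm. (2.7), Thm. 0.1.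
* [Shimura1998] G. Shimura (1998), §6.1 Thm. 2, §6.2 Thm. 3, §8.2 Prop. 26.
* [BirkenhakeLange2004] Ch. Birkenhake, H. Lange, *Complex Abelian Varieties*, 2nd ed. (2004), §13.3.
-/

noncomputable section

open scoped Classical nonZeroDivisors NumberField Manifold ContDiff MatrixGroups
open NumberField Module Polynomial

namespace Literature.Geometry.Kaehler

namespace ComplexTorus

-- `open scoped`: the tree's action of `Aut(ℂ)` on `Hom(K, ℂ)` by composition (`ringEquivCompAction`) is a scoped instance
open scoped Literature.NumberTheory.ComplexMultiplication
open Literature.NumberTheory.Automorphic (IsTorusSubgroup)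
open Literature.AlgebraicGeometry.Motives (CMType HodgeTensorFacts hodgeTensorFacts_holds)
open Literature.NumberTheory.ComplexMultiplication (IsPrimitive inducedCMType exists_primitive_inducedCMType_eq_of_isCMField)
open Literature.NumberTheory.ComplexMultiplication.CMTypeLattice (periodIso basisIndex card_basisIndex_eq_finrank
  isSimple_periodIso_iff_isPrimitive isIsogenous_powPeriod_periodIso_of_basis isAbelianVariety_periodIso)
open Literature.AlgebraicGeometry.ComplexMultiplication (isPrimitive_ringEquiv_complex_iff)
open Literature.AlgebraicGeometry.Pohlmann1968 (finrank_eq_two_of_not_isPrimitive_of_finrank_eq_two_mul_prime)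
open Literature.AlgebraicGeometry.Pohlmann1968.Cyclotomic (finrank_eq_totient)

/-! ### §1 The models `ℂ^ℓ/Φ(𝔞)` of a CM field of degree `2ℓ` -/

section Models

variable {K : Type} [Field K] [NumberField K] [IsCMField K] {ℓ : ℕ}

/-- **`Hdg(Xᵏ) = Div(Xᵏ)` FOR ALL `k`, `X = ℂ^ℓ/Φ(𝔞)`, FOR EVERY CM TYPE `Φ` OF EVERY CM FIELD OF DEGREE `2ℓ` (`ℓ` PRIME) AND EVERY IDEAL** —
primitive: Yanai–Tankeev–Ribet (simple, prime dimension, Mumford–Tate torus); non-primitive: `X ∼ E^ℓ`, `E` a CM elliptic curve.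
[cite: Yanai1985, §4 Theorem (p. 171)] [cite: Gordon1999HodgeAVSurvey, Thm. 6.3 (2), 7.5] [cite: MoonenZarhin1999LowDim, §2 Thm. (2.7)]
[cite: Shimura1998, §6.2 Thm. 3, §8.2 Prop. 26] -/
theorem divisorClasses_powPeriod_periodIso_eq_hodgeClasses_of_finrank_eq_two_mul_prime (hℓ : ℓ.Prime) (hK : finrank ℚ K = 2 * ℓ)
    (Φ : CMType K) (I : (FractionalIdeal (𝓞 K)⁰ K)ˣ) (k q : ℕ) :
    divisorClasses (powPeriod (periodIso Φ I) k) q = hodgeClasses (powPeriod (periodIso Φ I) k) q := by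
  haveI : HodgeTensorFacts.{0, 0} := hodgeTensorFacts_holds.{0, 0}
  obtain ⟨φ₀⟩ : Nonempty (K →+* ℂ) := inferInstance
  by_cases hΦ : IsPrimitive (ℂ ≃+* ℂ) Φ.1 φ₀
  · have hS : ComplexTorus.IsSimple (periodIso Φ I) := (isSimple_periodIso_iff_isPrimitive Φ I φ₀).2 hΦ
    have hcard : Fintype.card (basisIndex I) = 2 * ℓ := by rw [card_basisIndex_eq_finrank, hK]
    haveI : Nonempty (basisIndex I) := Fintype.card_pos_iff.1 (by rw [hcard]; have := hℓ.pos; omega)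
    exact (isAbelianVariety_periodIso Φ I).divisorClasses_powPeriod_eq_hodgeClasses_of_isSimple_of_card_eq_two_mul_prime_of_isTorusSubgroup_mumfordTateGroupC
      hS (isTorusSubgroup_mumfordTateGroupC_periodIso Φ I) hℓ hcard k q
  -- non-primitive: induced from an imaginary quadratic subfield
  obtain ⟨K₁, Φ₁, hCM, h₁, hp₁, hmin⟩ := exists_primitive_inducedCMType_eq_of_isCMField Φ
  haveI := hCM
  have hK₁ : finrank ℚ K₁ = 2 := finrank_eq_two_of_not_isPrimitive_of_finrank_eq_two_mul_prime hℓ hK hmin φ₀ hΦ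
  obtain ⟨s₀⟩ : Nonempty (K₁ →+* ℂ) := inferInstance
  have hS₁ : ComplexTorus.IsSimple (periodIso Φ₁ (1 : (FractionalIdeal (𝓞 K₁)⁰ K₁)ˣ)) :=
    (isSimple_periodIso_iff_isPrimitive Φ₁ 1 s₀).2 ((isPrimitive_ringEquiv_complex_iff Φ₁ s₀).2 hp₁)
  have hY := isAbelianVariety_periodIso Φ₁ (1 : (FractionalIdeal (𝓞 K₁)⁰ K₁)ˣ)
  have hiso := IsIsogenous.symm _ _ (isIsogenous_powPeriod_periodIso_of_basis h₁ (Module.finBasis K₁ K) I 1)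
  have hcard₁ : Fintype.card (basisIndex (1 : (FractionalIdeal (𝓞 K₁)⁰ K₁)ˣ)) ≤ 6 := by
    rw [card_basisIndex_eq_finrank, hK₁]; norm_num
  haveI : Nonempty (basisIndex (1 : (FractionalIdeal (𝓞 K₁)⁰ K₁)ˣ)) :=
    Fintype.card_pos_iff.1 (by rw [card_basisIndex_eq_finrank]; exact Module.finrank_pos)
  exact (forall_powPeriod_divisorClasses_eq_hodgeClasses_iff_of_isIsogenous_powPeriod hY Module.finrank_pos hiso).2
    (fun k q ↦ hY.divisorClasses_powPeriod_eq_hodgeClasses_of_isSimple_of_card_le_six_of_isTorusSubgroup_mumfordTateGroupC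
      hS₁ (isTorusSubgroup_mumfordTateGroupC_periodIso Φ₁ 1) hcard₁ k q) k q

end Models

/-! ### §2 Complex tori with `P_u = Φ_d`, `φ(d) = 2ℓ` -/

section Tori

variable {ι : Type} [Fintype ι] [DecidableEq ι] {E : Type} [NormedAddCommGroup E] [NormedSpace ℂ E]
  {P : (ι → ℝ) ≃L[ℝ] E} {d ℓ : ℕ}

set_option backward.isDefEq.respectTransparency false in -- Mathlib's instance
-- `IsCyclotomicExtension {d} ℚ (CyclotomicField d ℚ)` is keyed on `CyclotomicField.algebra`, the goal on
-- `DivisionRing.toRatAlgebra` (same workaround as `ComplexTorusCMTypeModelsHodgeClassesDegreeLeSix`)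
/-- **`Hdg(Xᵏ) = Div(Xᵏ)` FOR ALL `k`, FOR EVERY COMPLEX TORUS WITH AN ENDOMORPHISM OF CHARACTERISTIC POLYNOMIAL `Φ_d`, `d > 2`, `φ(d) = 2ℓ`, `ℓ` PRIME**
(`dim X = ℓ`; simple or not; e.g. `Φ₁₁`, `Φ₂₂`, `Φ₂₃`, `Φ₄₆`, `Φ₄₇`). [cite: Yanai1985, §4 Theorem (p. 171)] [cite: Gordon1999HodgeAVSurvey, Thm. 6.3 (2), 7.5]
[cite: Shimura1998, §6.1 Thm. 2, §6.2 Thm. 3] [cite: BirkenhakeLange2004, §13.3] -/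
theorem divisorClasses_powPeriod_eq_hodgeClasses_of_charpoly_eq_cyclotomic_of_totient_eq_two_mul_prime (hd : 2 < d) (hℓ : ℓ.Prime)
    (hφ : Nat.totient d = 2 * ℓ) {A : Matrix ι ι ℤ} (hA : A ∈ endRingInt P) (hP : A.charpoly = cyclotomic d ℤ) (k q : ℕ) :
    divisorClasses (powPeriod P k) q = hodgeClasses (powPeriod P k) q := by
  haveI : NeZero d := ⟨by omega⟩
  have hζ := IsCyclotomicExtension.zeta_spec d ℚ (CyclotomicField d ℚ)
  obtain ⟨Φ, I, e, he, he₂, -⟩ := exists_cmType_ideal_iso_of_charpoly_eq_cyclotomic hζ hA hP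
  haveI : IsCMField (CyclotomicField d ℚ) :=
    IsCyclotomicExtension.Rat.isCMField (CyclotomicField d ℚ) (S := ({d} : Set ℕ)) ⟨d, rfl, hd⟩
  have hK : finrank ℚ (CyclotomicField d ℚ) = 2 * ℓ := by rw [finrank_eq_totient d (CyclotomicField d ℚ), hφ]
  exact ((IsIsomorphic.isIsogenous ⟨e, he, he₂⟩).forall_powPeriod_divisorClasses_eq_hodgeClasses_iff.2
    (fun k q ↦ divisorClasses_powPeriod_periodIso_eq_hodgeClasses_of_finrank_eq_two_mul_prime hℓ hK Φ I k q)) k q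

end Tori

end ComplexTorus

end Literature.Geometry.Kaehler

end
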